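import Literature.NumberTheory.GaloisRepresentations.KummerCubicCharacterPeriodicity
import Literature.NumberTheory.GaloisRepresentations.CubicReciprocityRationalPrime
import Literature.NumberTheory.GaloisRepresentations.CubicCharacterOfTwo
import Literature.NumberTheory.GaloisRepresentations.EisensteinCubicIndex
import Literature.NumberTheory.NumberFields.ClassFieldsOfCharactersUniqueness
import Mathlib.NumberTheory.LSeries.PrimesInAP
import HarnessLib

/-!
# The cubic Kummer character `(D/·)₃`: conductor `9D₀`, triviality on rational integers, splitting
# (Ireland–Rosen Ch. 9 §3 Theorem 1 with Eisenstein's supplement; Cox §9.A (9.20)–(9.22))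

Topic `NumberTheory/GaloisRepresentations` (continues `KummerCubicCharacterPeriodicity.lean`); namespace
`Literature.NumberTheory.GaloisRepresentations`. THEOREMS only (no definition, no named fact, no
instance; D-0026), all unconditional, on the tree's PROVED Artin reciprocity for the cubic Kummer
extension `L = K(∛D) ⊆ K̄` of a number field `K ∋ ζ₃` (`exists_artinKillsRay_kummerChar`,
`kummerChar_galFrob`). Filed in support of `Literature/NumberTheory/EllipticCurves/RingClassFieldCubeRoots.lean`
(`∛D ∈ K[f]` for `K = ℚ(ω)`; Hu–Shu–Yin Prop. 2.4).

* `artinSymbol_kummerChar_eq_of_sub_mem_span_of_le` — **sharp periodicity of `(D/·)₃`**: the Artin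
  symbol of `v ↦ kummerChar(Frob_v)` agrees on `(b)` and `(c)` for `b ≡ c (mod 9D₀)`, `c` prime to
  `3D`, whenever `(9D₀) ⊆ (3D) ∋ (3D₀)^k` (the tree's `artinSymbol_kummerChar_eq_of_sub_mem_span` is
  the case `D₀ = D`; for `D = 3`, `D₀ = 1` this is the conductor `9 = λ⁴` of `K(∛3)/K` — Eisenstein's
  supplement `(3/π)₃ = ω^{2b}` depends on `π mod 9` — and for `D = 3p`, `D₀ = p` the conductor `9p`);
* `artinSymbol_kummerChar_span_intCast_eq_one` — for `K = ℚ(ω)` (`IsCyclotomicExtension {3} ℚ K`)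
  **the symbol of a rational integer `c` prime to `3D` is trivial** (Cox's argument (9.20)–(9.22) in
  the proof of Thm. 9.18: `(c) = (−c)`, so assume `c ≡ 2 (mod 3)`; by Dirichlet's theorem pick an
  inert prime `q ≡ c (mod 9D)` and use periodicity);
* `mem_splitPrimes_kummerField_of_kummerChar_eq_one` — `kummerChar(Frob_v) = 1 ⇒ v` splits
  completely in `K(∛D)` (`v ∤ 3D`).

## References

* K. Ireland, M. Rosen, *A Classical Introduction to Modern Number Theory*, 2nd ed. (1990), Ch. 9 §3
  Props. 9.3.2–9.3.3, Theorem 1 and §4 (proof, case `q ≡ 2 (3)`); Ch. 14 §2. [IrelandRosen1990]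
* D. A. Cox, *Primes of the form x² + ny²*, 2nd ed. (2013), §9.A, proof of Thm. 9.18, (9.20)–(9.23)
  (PDF pp. 205–206). [Cox2013]
* N. Childress, *Class Field Theory* (2009), Ch. 5 §2 Thm. 2.1 (Artin reciprocity, cyclic case) — as
  proved in the tree. [Childress2009]

## Mathlib / tree search

Tree: `kummerField`, `cubeRootL`, `cubeRootL_eq_gen`, `kummerChar_spec`, `kummerChar_galFrob`,
`kummerChar_pow_three`, `isUnramifiedIn_kummerField`, `exists_artinKillsRay_kummerChar`,
`exists_pow_three_sub_mem_of_pow_mem`, `artinSymbol_pow_three_eq_one`, `isEmpty_ringHom_real`,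
`artinSymbol_kummerChar_eq_of_sub_mem_span` (modulus `9D`), `artinSymbol_asIdeal`, `artinSymbol_mul`,
`three_not_mem_of_natCast_mem`, `cubicResidueSymbol_natCast_eq_one_of_residueCard_eq_sq` (REUSED from
`CubicCharacterOfTwo`, found by the gate's dedup lint),
`finrank_eq_two_of_isCyclotomicExtension_three`, `EisensteinCubic.isPrime_span_natCast`,
`mem_splitPrimes_iff_galFrob_eq_one`. Mathlib: `Nat.forall_exists_prime_gt_and_zmodEq` (Dirichlet),
`Ideal.absNorm_span_natCast`, `PowerBasis.algHom_ext`, `IntermediateField.adjoin.powerBasis`.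
`lean search 'kummerChar.*intCast|span_intCast_eq_one|Conductor'`: no prior hits for these statements.
-/

noncomputable section

open NumberField IsDedekindDomain IsDedekindDomain.HeightOneSpectrum
open scoped nonZeroDivisors IntermediateField Classical

namespace Literature.NumberTheory.GaloisRepresentations

open Literature.NumberTheory.NumberFields
open Literature.NumberTheory.LFunctions.AbelianDensity

variable {K : Type} [Field K] [NumberField K]

/-! ### Sharp periodicity of the cubic symbol: modulus `9D₀` -/

/-- **Periodicity of `(D/·)₃` modulo `9D₀`** whenever `(9D₀) ⊆ (3D)` and `(3D₀)^k ∈ (3D)` (so `3D`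
and `3D₀` have the same prime divisors): for nonzero `b, c ∈ 𝓞 K` with `c` prime to `3D` and
`b ≡ c (mod 9D₀)` the Artin symbols of `(b)` and `(c)` for `v ↦ kummerChar(Frob_v)` agree. Same proof
as the tree's `artinSymbol_kummerChar_eq_of_sub_mem_span` (the case `D₀ = D`): the CFT modulus `𝔪`
has all its primes above `3D`, so `(3D)^n ∈ 𝔪`, hence `(3D₀)^{kn} ∈ 𝔪`, and `b/c ≡ 1 + 9D₀s` is a
cube modulo `𝔪` (`exists_pow_three_sub_mem_of_pow_mem` applied to `D₀`). For `D = 3`, `D₀ = 1` this is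
the conductor `9 = λ⁴` of `K(∛3)/K` (Eisenstein's supplement `(3/π)₃ = ω^{2b}` depends on `π mod 9`).
[cite: Childress2009, Ch. 5 §2 Thm. 2.1] [cite: IrelandRosen1990, Ch. 9 §3 Theorem 1 and Ex. 9.23 (supplement)] -/
theorem artinSymbol_kummerChar_eq_of_sub_mem_span_of_le {ζ : 𝓞 K} (hζ : IsPrimitiveRoot ζ 3)
    {D : 𝓞 K} (hD : ∀ b : K, b ^ 3 ≠ (D : K)) (e : K →+* ℂ) [IsGalois K (kummerField D)]
    {D₀ : 𝓞 K} {k : ℕ} (hk : (3 * D₀) ^ k ∈ Ideal.span {3 * D})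
    (h9 : Ideal.span {9 * D₀} ≤ Ideal.span {3 * D}) {b c : 𝓞 K} (hb : b ≠ 0) (hc : c ≠ 0)
    (hcop : IsCoprime (Ideal.span {c}) (Ideal.span {3 * D})) (hbc : b - c ∈ Ideal.span {9 * D₀}) :
    artinSymbol (fun v ↦ kummerChar hζ hD e (galFrob K (kummerField D) v)) (Ideal.span {b}) =
      artinSymbol (fun v ↦ kummerChar hζ hD e (galFrob K (kummerField D) v)) (Ideal.span {c}) := by
  set f : HeightOneSpectrum (𝓞 K) → ℂˣ := fun v ↦ kummerChar hζ hD e (galFrob K (kummerField D) v)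
    with hfdef
  obtain ⟨𝔪, h𝔪, hsupp, hAKR⟩ := exists_artinKillsRay_kummerChar hζ hD e
  -- `(3D)^n ∈ 𝔪`, hence `(3D₀)^(k n) ∈ 𝔪`
  have hrad : 3 * D ∈ 𝔪.radical := by
    rw [Ideal.radical_eq_sInf, Ideal.mem_sInf]
    rintro P ⟨hP, hPprime⟩
    have hP0 : P ≠ ⊥ := fun h0 ↦ h𝔪 (le_bot_iff.mp (h0 ▸ hP))
    set v : HeightOneSpectrum (𝓞 K) := ⟨P, hPprime, hP0⟩
    exact hsupp v hP
  obtain ⟨n, hn⟩ := hrad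
  have hn' : (3 * D₀) ^ (k * n) ∈ 𝔪 := by
    obtain ⟨u, hu⟩ := Ideal.mem_span_singleton'.mp hk
    rw [pow_mul, ← hu, mul_pow]
    exact 𝔪.mul_mem_left _ hn
  -- `c` (hence anything `≡ c` modulo a multiple of `3D`) is prime to `𝔪`
  have hcopM : ∀ x : 𝓞 K, x - c ∈ Ideal.span {3 * D} → IsCoprime (Ideal.span {x}) 𝔪 := by
    intro x hx
    rw [Ideal.isCoprime_iff_sup_eq]
    by_contra hne
    obtain ⟨P, hPmax, hle⟩ := Ideal.exists_le_maximal _ hne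
    have hP0 : P ≠ ⊥ := fun h0 ↦ h𝔪 (le_bot_iff.mp (h0 ▸ (le_sup_right.trans hle)))
    set v : HeightOneSpectrum (𝓞 K) := ⟨P, hPmax.isPrime, hP0⟩
    have h3D : 3 * D ∈ P := hsupp v (le_sup_right.trans hle)
    have hxP : x ∈ P := hle (Ideal.mem_sup_left (Ideal.mem_span_singleton_self x))
    have hcP : c ∈ P := by
      have : c = x - (x - c) := by ring
      rw [this]
      exact P.sub_mem hxP ((Ideal.span_singleton_le_iff_mem _).mpr h3D hx)
    have htop : Ideal.span {c} ⊔ Ideal.span {3 * D} ≤ P :=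
      sup_le ((Ideal.span_singleton_le_iff_mem _).mpr hcP)
        ((Ideal.span_singleton_le_iff_mem _).mpr h3D)
    rw [Ideal.isCoprime_iff_sup_eq.mp hcop] at htop
    exact hPmax.ne_top (top_le_iff.mp htop)
  -- Bezout for `c`: `c c' ≡ 1 (mod 𝔪)`
  obtain ⟨a, ha, m₀, hm₀, ham⟩ := Submodule.mem_sup.mp
    ((Ideal.isCoprime_iff_sup_eq.mp (hcopM c (by simp))).symm ▸ Submodule.mem_top :
      (1 : 𝓞 K) ∈ Ideal.span {c} ⊔ 𝔪)
  obtain ⟨c', rfl⟩ := Ideal.mem_span_singleton'.mp ha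
  -- `b - c = 9 D₀ t`
  obtain ⟨t, ht⟩ := Ideal.mem_span_singleton'.mp hbc
  -- the cube `γ³ ≡ 1 + 9 D₀ (t c')`
  obtain ⟨γ, hγ⟩ := exists_pow_three_sub_mem_of_pow_mem 𝔪 D₀ (t * c') hn'
  -- `b ≡ γ³ c (mod 𝔪)`
  have hbγ : b - γ ^ 3 * c ∈ 𝔪 := by
    have e1 : b - γ ^ 3 * c = -(γ ^ 3 - (1 + 9 * D₀ * (t * c'))) * c + m₀ * (b - c) := by
      linear_combination (-(b - c)) * ham + (-(c' * c)) * ht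
    rw [e1]
    exact 𝔪.add_mem (𝔪.mul_mem_right _ (𝔪.neg_mem hγ)) (𝔪.mul_mem_right _ hm₀)
  -- the degenerate case `𝔪 = ⊤`
  by_cases htop : 𝔪 = ⊤
  · subst htop
    exact hAKR b c hb hc (Ideal.isCoprime_iff_sup_eq.mpr (by simp)) Submodule.mem_top
      fun φ ↦ ((isEmpty_ringHom_real hζ).false φ).elim
  -- coprimality is stable under congruence mod `𝔪`
  have hcong : ∀ x y : 𝓞 K, IsCoprime (Ideal.span {x}) 𝔪 → x - y ∈ 𝔪 →
      IsCoprime (Ideal.span {y}) 𝔪 := by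
    intro x y hx hxy
    rw [Ideal.isCoprime_iff_sup_eq, eq_top_iff, ← Ideal.isCoprime_iff_sup_eq.mp hx]
    refine sup_le ((Ideal.span_singleton_le_iff_mem _).mpr ?_) le_sup_right
    have : x = y + (x - y) := by ring
    rw [this]
    exact Submodule.add_mem_sup (Ideal.mem_span_singleton_self y) hxy
  have hbcop : IsCoprime (Ideal.span {b}) 𝔪 := hcopM b (h9 hbc)
  have hγc0 : γ ^ 3 * c ≠ 0 := by
    intro h0
    rw [h0, sub_zero] at hbγ
    apply htop
    rw [← Ideal.isCoprime_iff_sup_eq.mp hbcop]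
    exact (sup_eq_right.mpr ((Ideal.span_singleton_le_iff_mem _).mpr hbγ)).symm
  have hγ0 : γ ≠ 0 := fun h ↦ hγc0 (by rw [h]; ring)
  -- Artin reciprocity: `S(b) = S(γ³ c) = S(γ)³ S(c) = S(c)`
  have h1 := hAKR b (γ ^ 3 * c) hb hγc0 (hcong b _ hbcop hbγ) hbγ
    fun φ ↦ ((isEmpty_ringHom_real hζ).false φ).elim
  rw [h1, show Ideal.span {γ ^ 3 * c} =
      Ideal.span {γ} * Ideal.span {γ} * Ideal.span {γ} * Ideal.span {c} by
    rw [Ideal.span_singleton_mul_span_singleton, Ideal.span_singleton_mul_span_singleton,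
      Ideal.span_singleton_mul_span_singleton]; ring_nf]
  have hγI : Ideal.span {γ} ≠ ⊥ := by rwa [Ne, Ideal.span_singleton_eq_bot]
  have hcI : Ideal.span {c} ≠ ⊥ := by rwa [Ne, Ideal.span_singleton_eq_bot]
  rw [artinSymbol_mul f (mul_ne_zero (mul_ne_zero hγI hγI) hγI) hcI,
    artinSymbol_mul f (mul_ne_zero hγI hγI) hγI, artinSymbol_mul f hγI hγI]
  have h3 := artinSymbol_pow_three_eq_one (f := f) (fun v ↦ kummerChar_pow_three hζ hD e _)
    (Ideal.span {γ})
  rw [← pow_three', h3, one_mul]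

/-! ### The cubic symbol of a rational integer is trivial -/

/-- If the rational prime `q` lies in `𝔮` and `n` is prime to `q`, then `n ∉ 𝔮`. [folklore] -/
private theorem natCast_not_mem_of_natCast_mem {𝔮 : HeightOneSpectrum (𝓞 K)} {q n : ℕ}
    (hq : (q : 𝓞 K) ∈ 𝔮.asIdeal) (hqn : Nat.Coprime q n) : (n : 𝓞 K) ∉ 𝔮.asIdeal := by
  intro hn
  obtain ⟨a, b, hab⟩ := Nat.isCoprime_iff_coprime.mpr hqn
  have h1 : (1 : 𝓞 K) ∈ 𝔮.asIdeal := by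
    have e : (1 : 𝓞 K) = (a : 𝓞 K) * q + (b : 𝓞 K) * n := by exact_mod_cast hab.symm
    rw [e]
    exact 𝔮.asIdeal.add_mem (𝔮.asIdeal.mul_mem_left _ hq) (𝔮.asIdeal.mul_mem_left _ hn)
  exact 𝔮.isPrime.ne_top ((Ideal.eq_top_iff_one _).mpr h1)

/-- The inert prime `(q)` of `K = ℚ(ω)` for a rational prime `q ≡ 2 (mod 3)`, as a finite place
with `N(q) = q²`. [folklore] -/
private theorem exists_place_span_natCast [IsCyclotomicExtension {3} ℚ K] {q : ℕ} (hq : q.Prime)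
    (hq3 : q % 3 = 2) :
    ∃ 𝔮 : HeightOneSpectrum (𝓞 K), 𝔮.asIdeal = Ideal.span {(q : 𝓞 K)} ∧ 𝔮.residueCard = q ^ 2 := by
  have hprime : (Ideal.span {(q : 𝓞 K)}).IsPrime := EisensteinCubic.isPrime_span_natCast hq hq3
  have hne : Ideal.span {(q : 𝓞 K)} ≠ ⊥ := by
    rw [Ne, Ideal.span_singleton_eq_bot]; exact_mod_cast hq.ne_zero
  refine ⟨⟨Ideal.span {(q : 𝓞 K)}, hprime, hne⟩, rfl, ?_⟩
  show Ideal.absNorm (Ideal.span {(q : 𝓞 K)}) = q ^ 2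
  rw [Ideal.absNorm_span_natCast, RingOfIntegers.rank, finrank_eq_two_of_isCyclotomicExtension_three]

/-- **The `(D/·)₃`-symbol of a rational integer prime to `3D` is trivial** (`K = ℚ(ω)`): for
`c ∈ ℤ` prime to `3D` the Artin symbol of the principal ideal `(c)` for `v ↦ kummerChar(Frob_v)` is
`1`. Cox's argument for (9.22) in the proof of Thm. 9.18: `(c) = (−c)`, so one may assume
`c ≡ 2 (mod 3)`; by Dirichlet's theorem there is a prime `q ≡ c (mod 9D)`, `q > 3D`; periodicity
(`artinSymbol_kummerChar_eq_of_sub_mem_span`) replaces `(c)` by the inert prime `(q)`, whose symbol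
is `e(χ_{(q)}(D)) = 1` (`kummerChar_galFrob` and the tree's `cubicResidueSymbol_natCast_eq_one_of_residueCard_eq_sq`
of `CubicCharacterOfTwo`: `D^{(q²−1)/3} = (D^{q−1})^{(q+1)/3} ≡ 1`).
[cite: Cox2013, §9.A proof of Thm. 9.18, (9.20)–(9.22) (PDF pp. 205–206)] [cite: IrelandRosen1990, Ch. 9 §3 Theorem 1] -/
theorem artinSymbol_kummerChar_span_intCast_eq_one [IsCyclotomicExtension {3} ℚ K] {ζ : 𝓞 K}
    (hζ : IsPrimitiveRoot ζ 3) {D : ℕ} (hD : ∀ b : K, b ^ 3 ≠ ((D : 𝓞 K) : K)) (e : K →+* ℂ)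
    [IsGalois K (kummerField (D : 𝓞 K))] {c : ℤ} (hc : IsCoprime c (3 * D : ℤ)) :
    artinSymbol (fun v ↦ kummerChar hζ hD e (galFrob K (kummerField (D : 𝓞 K)) v))
      (Ideal.span {(c : 𝓞 K)}) = 1 := by
  set F : HeightOneSpectrum (𝓞 K) → ℂˣ :=
    fun v ↦ kummerChar hζ hD e (galFrob K (kummerField (D : 𝓞 K)) v) with hFdef
  have hD0 : D ≠ 0 := by
    rintro rfl
    exact hD 0 (by simp)
  -- `3 ∤ x` for `x` prime to `3D`, and such `x` are nonzero
  have h3ndvd : ∀ x : ℤ, IsCoprime x (3 * D : ℤ) → ¬ (3 : ℤ) ∣ x := by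
    intro x hx h3x
    obtain ⟨y, rfl⟩ := h3x
    have h33 : IsCoprime (3 : ℤ) 3 := hx.of_mul_left_left.of_mul_right_left
    exact absurd (isCoprime_self.mp h33) (by norm_num [Int.isUnit_iff])
  -- a sign `s = ±c` with `s ≡ 2 (mod 3)` and `(s) = (c)` (Cox: `(c) = (−c)`)
  obtain ⟨s, hs3, hs, hspan⟩ : ∃ s : ℤ, s % 3 = 2 ∧ IsCoprime s (3 * D : ℤ) ∧
      Ideal.span {(s : 𝓞 K)} = Ideal.span {(c : 𝓞 K)} := by
    have hc3 := h3ndvd c hc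
    rcases (by omega : c % 3 = 1 ∨ c % 3 = 2) with h | h
    · refine ⟨-c, by omega, hc.neg_left, ?_⟩
      rw [Int.cast_neg, Ideal.span_singleton_neg]
    · exact ⟨c, h, hc, rfl⟩
  have hs0 : s ≠ 0 := by
    rintro rfl
    exact h3ndvd 0 hs (dvd_zero 3)
  have hs9 : IsCoprime s (((9 * D : ℕ) : ℤ)) := by
    have h3 : IsCoprime s 3 := hs.of_isCoprime_of_dvd_right ⟨(D : ℤ), by ring⟩
    have hDc : IsCoprime s (D : ℤ) := hs.of_isCoprime_of_dvd_right ⟨3, by ring⟩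
    have : IsCoprime s (3 * 3 * (D : ℤ)) := (h3.mul_right h3).mul_right hDc
    convert this using 1
    push_cast
    ring
  -- Dirichlet: an inert prime `p ≡ s (mod 9D)`, `p > 3D`
  obtain ⟨p, hpgt, hp, hps⟩ :=
    Nat.forall_exists_prime_gt_and_zmodEq (3 * D) (by positivity : 9 * D ≠ 0) hs9
  have hp3 : p % 3 = 2 := by
    have h := (hps.of_dvd (⟨3 * D, by push_cast; ring⟩ : (3 : ℤ) ∣ ((9 * D : ℕ) : ℤ)))
    have h' : ((p : ℕ) : ℤ) % 3 = s % 3 := h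
    omega
  have hpD : ¬ p ∣ D := fun h ↦ by
    have := Nat.le_of_dvd (Nat.pos_of_ne_zero hD0) h
    omega
  have hp3' : Nat.Coprime p 3 := (Nat.coprime_primes hp Nat.prime_three).mpr (by omega)
  -- periodicity modulo `9D`: `S((p)) = S((s))`
  have hb : (p : 𝓞 K) ≠ 0 := by exact_mod_cast hp.ne_zero
  have hc' : (s : 𝓞 K) ≠ 0 := by exact_mod_cast hs0
  have hcop : IsCoprime (Ideal.span {(s : 𝓞 K)}) (Ideal.span {3 * (D : 𝓞 K)}) := by
    rw [Ideal.isCoprime_span_singleton_iff]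
    simpa using hs.map (Int.castRingHom (𝓞 K))
  have hbc : (p : 𝓞 K) - (s : 𝓞 K) ∈ Ideal.span {9 * (D : 𝓞 K)} := by
    obtain ⟨m, hm⟩ := hps.dvd
    refine Ideal.mem_span_singleton'.mpr ⟨((-m : ℤ) : 𝓞 K), ?_⟩
    have h := congrArg (Int.cast : ℤ → 𝓞 K) hm
    push_cast at h ⊢
    linear_combination h
  have hper : artinSymbol F (Ideal.span {(p : 𝓞 K)}) = artinSymbol F (Ideal.span {(s : 𝓞 K)}) :=
    artinSymbol_kummerChar_eq_of_sub_mem_span hζ hD e hb hc' hcop hbc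
  -- the inert place `𝔮 = (p)` and its symbol `e(χ_𝔮(D)) = 1`
  obtain ⟨𝔮, h𝔮, hcard⟩ := exists_place_span_natCast (K := K) hp hp3
  have hq𝔮 : (p : 𝓞 K) ∈ 𝔮.asIdeal := by rw [h𝔮]; exact Ideal.mem_span_singleton_self _
  have hD𝔮 : (D : 𝓞 K) ∉ 𝔮.asIdeal :=
    natCast_not_mem_of_natCast_mem hq𝔮 (hp.coprime_iff_not_dvd.mpr hpD)
  have h3𝔮 : (3 : 𝓞 K) ∉ 𝔮.asIdeal := three_not_mem_of_natCast_mem hq𝔮 hp3'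
  rw [← hspan, ← hper, ← h𝔮, artinSymbol_asIdeal]
  apply Units.ext
  haveI : Fact p.Prime := ⟨hp⟩
  rw [hFdef, kummerChar_galFrob hζ hD e 𝔮 hD𝔮 h3𝔮, map_natCast,
    cubicResidueSymbol_natCast_eq_one_of_residueCard_eq_sq hζ hp3 hq𝔮 hcard hpD]
  simp

/-! ### Splitting in `K(∛D)` from a trivial Kummer character value -/

/-- **`kummerChar(Frob_v) = 1 ⇒ v` splits completely in `K(∛D)`** (`v ∤ 3D`): the Frobenius fixes
the generator `∛D` (`kummerChar_spec`, `e` injective), hence is the identity on the power basis of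
`K(∛D) = K⟮∛D⟯`, and an unramified prime with trivial Frobenius splits completely
(`mem_splitPrimes_iff_galFrob_eq_one`). [cite: IrelandRosen1990, Ch. 14 §2 (power residue symbol = Frobenius on ⁿ√a)] -/
theorem mem_splitPrimes_kummerField_of_kummerChar_eq_one {ζ : 𝓞 K} (hζ : IsPrimitiveRoot ζ 3)
    {D : 𝓞 K} (hD : ∀ b : K, b ^ 3 ≠ (D : K)) (e : K →+* ℂ) [IsGalois K (kummerField D)]
    {v : HeightOneSpectrum (𝓞 K)} (hDv : D ∉ v.asIdeal) (h3v : (3 : 𝓞 K) ∉ v.asIdeal)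
    (h1 : kummerChar hζ hD e (galFrob K (kummerField D) v) = 1) :
    v ∈ splitPrimes K (kummerField D) := by
  rw [mem_splitPrimes_iff_galFrob_eq_one (isUnramifiedIn_kummerField hζ v hDv h3v)]
  set σ := galFrob K (kummerField D) v with hσdef
  obtain ⟨u, -, hval, hσu⟩ := kummerChar_spec hζ hD e σ
  have hu : (u : K) = 1 := by
    apply e.injective
    rw [map_one, ← hval, h1, Units.val_one]
  have hfix : σ (cubeRootL D) = cubeRootL D := by rw [hσu, hu, one_smul]
  have key : (σ : kummerField D →ₐ[K] kummerField D) = AlgHom.id K (kummerField D) := by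
    refine (IntermediateField.adjoin.powerBasis (isIntegral_cubeRoot D)).algHom_ext ?_
    rw [IntermediateField.adjoin.powerBasis_gen, ← cubeRootL_eq_gen]
    simpa using hfix
  refine AlgEquiv.ext fun x ↦ ?_
  simpa using congrArg (fun g : kummerField D →ₐ[K] kummerField D ↦ g x) key

end Literature.NumberTheory.GaloisRepresentations

end
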